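import Summits.CriticalPhenomena.Ising3DConformalLimit.Theorems.HyperoctahedralRPExistsScaleCovariantLimitNonSeparableModulusOfUniformRegularity
import Summits.CriticalPhenomena.Ising3DConformalLimit.Theorems.HyperoctahedralRPExistsScaleCovariantLimitCompactnessItemMapsDoubling
import Summits.CriticalPhenomena.Ising3DConformalLimit.Theorems.MonotoneBlockingBlockingGivesRegularity
import Summits.CriticalPhenomena.Ising3DConformalLimit.Theorems.MonotoneBlockingBlockingGivesLimit
import Summits.CriticalPhenomena.Ising3DConformalLimit.Theorems.MirrorHoelderCompactnessSeparableHoelder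
import Summits.CriticalPhenomena.Ising3DConformalLimit.Theorems.MirrorHoelderCompactnessCompactnessGlue
import Summits.CriticalPhenomena.Ising3DConformalLimit.Theorems.MirrorHoelderCompactnessLimitConstruction
import HarnessLib

/-!
# `NonSeparableModulus` (item stmt-CriticalPhenomena-6152) is implied by each sibling rank-2 crux
(crux-strategist glue for routes `MonotoneBlocking` and `MirrorHoelderCompactness`,
sub-problem `CriticalPhenomena/Ising3DConformalLimit`; `--supports stmt-CriticalPhenomena-6152`)

The crux `NonSeparableModulus` (NS: asymptotic equicontinuity of the `ρ★`-rescaled critical `ℤ³` Ising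
correlators under one-point moves at mirror-caged configurations) is wanted verbatim by two routes, in
each of which it sits next to a rank-2 crux that ALREADY implies it through landed theorems:

* `nonSeparableModulus_of_twoPointDoubling` : `TwoPointDoubling` (item 6150, route
  `MirrorHoelderCompactness`) `→ NS` — composition of the landed
  `ItemMaps.uniformRegularity_of_doubling` (6150 ⟹ 4658) and
  `TwoHierarchies.stub_nonSeparableModulus_of_uniformRegularity` (4658 ⟹ 6152);
* `nonSeparableModulus_of_monotoneBlockingTwo` : `MonotoneBlockingTwo` (item 17054, BM₂, route
  `MonotoneBlocking`) `→ NS` — through the landed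
  `MonotoneBlockingBlockingGivesRegularity.uniformRegularity_of_monotoneBlockingTwo` (17054 ⟹ 4658).

Consequently the binder `hNS` of BOTH deciding theorems is derivable from another binder of the same
theorem, and NS is not load-bearing in either route. The two re-glued deciding theorems are recorded
here for the tenure planners (`monotoneBlocking_closes_without_NS`,
`mirrorHoelderCompactness_closes_without_NS`), together with the fully reduced forms that also discharge
the supports proved meanwhile (`monotoneBlocking_closes_min` : BM₂ → BM_mom → LAC → summit conjunct;
`mirrorHoelderCompactness_closes_min` : D → PL → LAC → summit conjunct).

No lattice input beyond the landed theorems named; no definitions, no named-fact hypotheses, no `sorry`.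
References: M. Aizenman, H. Duminil-Copin, Ann. of Math. 194 (2021), arXiv:1912.07973 (Remark 5.10:
all-scale regularity open); folklore logic otherwise. [folklore]
-/

namespace Summit.CriticalPhenomena.Ising3DConformalLimit.MonotoneBlockingNonSeparableModulusOfSiblingCruxes

open Summit.CriticalPhenomena.Ising3DConformalLimit.Theses
open Summit.CriticalPhenomena.Ising3DConformalLimit.Cruxes.ExistsScaleCovariantLimit

/-- **4658 ⟹ 6152** (landed `stub_nonSeparableModulus_of_uniformRegularity`, re-keyed to the
`MonotoneRG` / `MonotoneBlocking` copies: the two route copies of item 4658, and of item 6152, are the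
same propositions definitionally). [folklore] -/
theorem nonSeparableModulus_of_uniformRegularity (h : MonotoneRG.UniformRegularity) :
    MonotoneBlocking.NonSeparableModulus :=
  TwoHierarchies.stub_nonSeparableModulus_of_uniformRegularity h

/-- **6150 ⟹ 6152**: all-scale axial doubling of the critical two-point function gives the
non-separable modulus (via 4658). [folklore] -/
theorem nonSeparableModulus_of_twoPointDoubling (hD : MirrorHoelderCompactness.TwoPointDoubling) :
    MonotoneBlocking.NonSeparableModulus :=
  nonSeparableModulus_of_uniformRegularity (TwoHierarchies.ItemMaps.uniformRegularity_of_doubling hD)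

/-- The same, concluding the `MirrorHoelderCompactness` copy of the crux. [folklore] -/
theorem mirror_nonSeparableModulus_of_twoPointDoubling
    (hD : MirrorHoelderCompactness.TwoPointDoubling) :
    MirrorHoelderCompactness.NonSeparableModulus :=
  nonSeparableModulus_of_twoPointDoubling hD

/-- **17054 ⟹ 6152**: all-scale monotone blocking of the critical block covariances (BM₂) gives the
non-separable modulus (BM₂ ⟹ 4658 is landed). [folklore] -/
theorem nonSeparableModulus_of_monotoneBlockingTwo (h : MonotoneBlocking.MonotoneBlockingTwo) :
    MonotoneBlocking.NonSeparableModulus :=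
  nonSeparableModulus_of_uniformRegularity
    (MonotoneBlockingBlockingGivesRegularity.uniformRegularity_of_monotoneBlockingTwo h)

/-- Route `MonotoneBlocking`: the deciding theorem with the binder `hNS` removed (it is derived from
`hBM2`). Candidate `closes` for `ledger route edit … --drop NonSeparableModulus`. [folklore] -/
theorem monotoneBlocking_closes_without_NS
    (hBM2 : MonotoneBlocking.MonotoneBlockingTwo) (hBMM : MonotoneBlocking.MonotoneBlockingMoments)
    (hLAC : MonotoneBlocking.LimitsAreConformal)
    (hReg : MonotoneBlocking.BlockingGivesRegularity) (hLim : MonotoneBlocking.BlockingGivesLimit) :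
    _root_.Ising3DConformalLimit :=
  MonotoneBlocking.closes hBM2 hBMM (nonSeparableModulus_of_monotoneBlockingTwo hBM2) hLAC hReg hLim

/-- Route `MonotoneBlocking`, fully reduced: with the supports 17056/17057 proved
(`blockingGivesRegularity_proof`, `blockingGivesLimit_proof`), the sub-problem follows from the three
open cruxes BM₂, BM_mom and LAC alone. [folklore] -/
theorem monotoneBlocking_closes_min
    (hBM2 : MonotoneBlocking.MonotoneBlockingTwo) (hBMM : MonotoneBlocking.MonotoneBlockingMoments)
    (hLAC : MonotoneBlocking.LimitsAreConformal) : _root_.Ising3DConformalLimit :=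
  monotoneBlocking_closes_without_NS hBM2 hBMM hLAC
    MonotoneBlockingBlockingGivesRegularity.blockingGivesRegularity_proof
    MonotoneBlockingLimit.blockingGivesLimit_proof

/-- Route `MirrorHoelderCompactness`: the deciding theorem with the binder `hNS` removed (it is
derived from `hD`). Candidate `closes` for `ledger route edit … --drop NonSeparableModulus`. [folklore] -/
theorem mirrorHoelderCompactness_closes_without_NS
    (hD : MirrorHoelderCompactness.TwoPointDoubling) (hSH : MirrorHoelderCompactness.SeparableHoelder)
    (hPL : MirrorHoelderCompactness.PointwiseLimit) (hCG : MirrorHoelderCompactness.CompactnessGlue)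
    (hLC : MirrorHoelderCompactness.LimitConstruction)
    (hLAC : MirrorHoelderCompactness.LimitsAreConformal) : _root_.Ising3DConformalLimit :=
  MirrorHoelderCompactness.closes hD hSH (mirror_nonSeparableModulus_of_twoPointDoubling hD) hPL hCG hLC
    hLAC

/-- Route `MirrorHoelderCompactness`, fully reduced: with `SeparableHoelder` (6151), `CompactnessGlue`
(6158) and `LimitConstruction` (6159) proved, the sub-problem follows from the three open cruxes
D (6150), PL (6153) and LAC (6154) alone. [folklore] -/
theorem mirrorHoelderCompactness_closes_min
    (hD : MirrorHoelderCompactness.TwoPointDoubling) (hPL : MirrorHoelderCompactness.PointwiseLimit)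
    (hLAC : MirrorHoelderCompactness.LimitsAreConformal) : _root_.Ising3DConformalLimit :=
  mirrorHoelderCompactness_closes_without_NS hD
    MirrorHoelderCompactnessSeparableHoelder.separableHoelder_proof hPL
    MirrorHoelderCompactnessGlue.compactnessGlue_proof
    MirrorHoelderLimitConstruction.limitConstruction_proof hLAC

end Summit.CriticalPhenomena.Ising3DConformalLimit.MonotoneBlockingNonSeparableModulusOfSiblingCruxes
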